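import Mathlib
import HarnessLib

/-!
# Smith's determinant and GCD matrices on `{1, …, n}`

Topic `NumberTheory/Multiplicative`; **proof file** (definitions with bodies + theorems; no named
facts, D-0014/D-0026).

For an arithmetical function `f` the **GCD matrix** of `f` on `{1, …, n}` is
`(f(gcd(i,j)))_{1 ≤ i,j ≤ n}`.  Writing `f = g ∗ 𝟙`, i.e. `f(m) = ∑_{d ∣ m} g(d)` (`g = f ∗ μ`), one
has the congruence ("structure theorem")

  `(f(gcd(i,j))) = Dₙᵀ · diag(g(1), …, g(n)) · Dₙ`,  `Dₙ = ([i ∣ j])_{i,j ≤ n}`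

with the upper unitriangular divisibility matrix `Dₙ` (as in
`Literature.NumberTheory.Multiplicative.Redheffer.divisibility`; Beslin–Ligh 1989, Thm. 1 and
Remark 1, for `f = N`, `g = φ`; Bourque–Ligh, Thm. 1, general `f`; `{1, …, n}` is factor-closed).
Consequences proved here:

* `Smith.det_gcdMatrix` — `det (f(gcd(i,j))) = g(1) ⋯ g(n)` (Bourque–Ligh 1993/1995 Thm. 1 (iii));
  `Smith.det_gcd` — **Smith's determinant** (1875/76) `det (gcd(i,j))_{i,j ≤ n} = φ(1) φ(2) ⋯ φ(n)`
  (Beslin–Ligh 1989, Cor. 2); `Smith.det_gcd_pow` — `det (gcd(i,j)^s) = J_s(1) ⋯ J_s(n)` with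
  Jordan's totient `J_s = μ ∗ N^s`.
* `Smith.posDef_gcdMatrix` — if `g(k) > 0` for `1 ≤ k ≤ n` then `(f(gcd(i,j)))` is positive definite
  over `ℝ` (Bourque–Ligh Thm. 1 (i): `f ∈ C_S`); `Smith.posDef_gcd` — the GCD matrix `(gcd(i,j))` is
  positive definite (Beslin–Ligh 1989, Thm. 2); `Smith.posDef_gcd_pow` — so is every power GCD
  matrix `(gcd(i,j)^s)`, `s ≥ 1` (`N^s ∈ C_S`, Bourque–Ligh 1995 p. 268), via `J_s > 0`
  (`Smith.jordan_pos`).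
* `Smith.posDef_mikolasGram` — the Gram matrix of the dilated Bernoulli functions
  `P_{2r+1}(a·)`, `a ≤ x`, in `L²(0,1)`: `G_r[a][b] = c_r · gcd(a,b)^{4r+2}/(ab)^{2r+1}` (Mikolás 1949,
  Lemma 5; `r = 0`: Franel's `gcd(a,b)²/(12ab)`), is positive definite for every `x` — stated for
  any `c > 0` and exponent pattern `gcd^{2t}/(ab)^t`, `t ≥ 1`.

## References

* [Smith1875] H. J. S. Smith, *On the value of a certain arithmetical determinant*, Proc. London
  Math. Soc. (1) 7 (1875/76) 208–212 (cited through Beslin–Ligh).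
* [BeslinLigh1989] S. Beslin, S. Ligh, *Greatest common divisor matrices*, Linear Algebra Appl.
  118 (1989) 69–76: Thm. 1 + Remark 1 (`[S] = E Λ Eᵀ`, `Λ = diag φ`), Cor. 1, Thm. 2 (`[S]` positive
  definite), Cor. 2 (Smith) (read at page).
* [BourqueLigh1995] K. Bourque, S. Ligh, *Matrices associated with multiplicative functions*,
  Linear Algebra Appl. 216 (1995) 267–275: Def. 1 (`C_S`), Thm. 1 (= Bourque–Ligh, J. Number
  Theory 45 (1993), Thm. 1: `f ∈ C_S ⟹ (f(xᵢ,xⱼ))` positive definite; `det = ∏ (f∗μ)(x_k)` iff `S`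
  factor-closed), remark `ε_e(m) = m^e ∈ C_S` (p. 268) (read at page).
* [Mikolas1949] M. Mikolás, *Farey series and their connection with the prime number problem I*,
  Acta Sci. Math. (Szeged) 13 (1949) 93–117, Lemma 5 (the Gram `c_r (a,b)^{4r+2}/(ab)^{2r+1}`).

## Mathlib / tree search

Mathlib has no GCD matrices / Smith determinant (`lean search "gcd.*Matrix|Smith"`: none relevant,
2026-08-20).  Used: `Nat.sum_totient`, `ArithmeticFunction.coe_zeta_mul_moebius`,
`ArithmeticFunction.IsMultiplicative.multiplicative_factorization`, `Nat.divisors_prime_pow`,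
`Matrix.det_of_upperTriangular`, `Matrix.PosDef.diagonal`, `Matrix.PosDef.conjTranspose_mul_mul_same`,
`Matrix.mulVec_injective_iff_isUnit`.  The divisibility matrix is the one of `RedhefferMatrix.lean`
(`Redheffer.divisibility`, over `ℤ`), restated here over a general commutative ring.
-/

open Finset Matrix
open scoped ArithmeticFunction.Moebius

namespace Literature.NumberTheory.Multiplicative

namespace Smith

section Defs

variable {R : Type*}

/-! ## The matrices -/

/-- The **GCD matrix** of an arithmetical function `f` on `{1, …, n}`: rows/columns indexed by
`Fin n` (`i ↦ i + 1`), entry `f(gcd(i+1, j+1))`. [cite: BourqueLigh1995, §1 (the matrix `(f(xᵢ,xⱼ))`)] -/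
def gcdMatrix (f : ℕ → R) (n : ℕ) : Matrix (Fin n) (Fin n) R :=
  Matrix.of fun i j : Fin n => f (Nat.gcd ((i : ℕ) + 1) ((j : ℕ) + 1))

/-- Entry formula for `gcdMatrix`. [cite: BourqueLigh1995, §1] -/
theorem gcdMatrix_apply (f : ℕ → R) (n : ℕ) (i j : Fin n) :
    gcdMatrix f n i j = f (Nat.gcd ((i : ℕ) + 1) ((j : ℕ) + 1)) := rfl

end Defs

section Ring

variable {R : Type*} [CommRing R]

/-- The divisibility (incidence) matrix `Dₙ = ([i ∣ j])_{1 ≤ i,j ≤ n}` over a commutative ring `R`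
(index `i : Fin n` ↦ the integer `i + 1`); this is the matrix `E` of Beslin–Ligh with
`D = S = {1, …, n}` (transposed convention `e_{ij} = [dᵢ ∣ xⱼ]`), and for `R = ℤ` it is the matrix
`Literature.NumberTheory.Multiplicative.Redheffer.divisibility` of `RedhefferMatrix.lean` (same
entry formula; kept over a general `R` here). [cite: BeslinLigh1989, Thm 1 (proof)] -/
def divisibility (n : ℕ) : Matrix (Fin n) (Fin n) R :=
  Matrix.of fun i j : Fin n => if (i : ℕ) + 1 ∣ (j : ℕ) + 1 then (1 : R) else 0

/-- Entry formula for `divisibility`. [cite: BeslinLigh1989, Thm 1 (proof)] -/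
theorem divisibility_apply (n : ℕ) (i j : Fin n) :
    (divisibility n : Matrix (Fin n) (Fin n) R) i j =
      if (i : ℕ) + 1 ∣ (j : ℕ) + 1 then (1 : R) else 0 := rfl

/-- `Dₙ` is upper unitriangular, so `det Dₙ = 1`. [cite: BeslinLigh1989, Thm 2 (proof)] -/
theorem det_divisibility (n : ℕ) : (divisibility n : Matrix (Fin n) (Fin n) R).det = 1 := by
  have hT : (divisibility n : Matrix (Fin n) (Fin n) R).BlockTriangular id := by
    intro i j hij
    have h1 : (j : ℕ) < (i : ℕ) := hij
    rw [divisibility_apply]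
    apply if_neg
    intro hdvd
    have := Nat.le_of_dvd (Nat.succ_pos _) hdvd
    omega
  rw [Matrix.det_of_upperTriangular hT]
  refine Finset.prod_eq_one fun i _ => ?_
  simp [divisibility_apply]

/-- Reindexing a sum over `Fin n` by `k ↦ k + 1 ∈ (0, n]`. [folklore] -/
private theorem sum_fin_succ_eq_sum_Ioc {M : Type*} [AddCommMonoid M] (n : ℕ) (F : ℕ → M) :
    ∑ k : Fin n, F ((k : ℕ) + 1) = ∑ m ∈ Ioc 0 n, F m := by
  refine Finset.sum_bij' (fun k _ => (k : ℕ) + 1)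
    (fun m hm => ⟨m - 1, by have := Finset.mem_Ioc.1 hm; omega⟩) ?_ ?_ ?_ ?_ ?_
  · intro k _
    exact Finset.mem_Ioc.2 ⟨Nat.succ_pos _, k.2⟩
  · intro m _
    exact Finset.mem_univ _
  · intro k _
    ext
    simp
  · intro m hm
    have := Finset.mem_Ioc.1 hm
    simp only
    omega
  · intro k _
    rfl

/-! ## The structure theorem and Smith's determinant -/

/-- **Structure theorem** (on the factor-closed set `{1, …, n}`):
`Dₙᵀ · diag(g(1), …, g(n)) · Dₙ = (f(gcd(i,j)))` with `f(m) = ∑_{d ∣ m} g(d)`.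
[cite: BeslinLigh1989, Thm 1 and Remark 1; BourqueLigh1995, Thm 1 (proof)] -/
theorem transpose_mul_diagonal_mul (g : ℕ → R) (n : ℕ) :
    (divisibility n : Matrix (Fin n) (Fin n) R)ᵀ *
        Matrix.diagonal (fun k : Fin n => g ((k : ℕ) + 1)) * divisibility n =
      gcdMatrix (fun m => ∑ d ∈ m.divisors, g d) n := by
  ext i j
  rw [Matrix.mul_apply, gcdMatrix_apply]
  have h1 : ∀ k : Fin n,
      ((divisibility n : Matrix (Fin n) (Fin n) R)ᵀ *
          Matrix.diagonal (fun k : Fin n => g ((k : ℕ) + 1))) i k *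
        (divisibility n : Matrix (Fin n) (Fin n) R) k j =
      (fun d : ℕ => if d ∣ (i : ℕ) + 1 ∧ d ∣ (j : ℕ) + 1 then g d else 0) ((k : ℕ) + 1) := by
    intro k
    rw [Matrix.mul_diagonal, Matrix.transpose_apply, divisibility_apply, divisibility_apply]
    by_cases hi : (k : ℕ) + 1 ∣ (i : ℕ) + 1 <;> by_cases hj : (k : ℕ) + 1 ∣ (j : ℕ) + 1 <;>
      simp [hi, hj]
  rw [Finset.sum_congr rfl fun k _ => h1 k,
    sum_fin_succ_eq_sum_Ioc n (fun d : ℕ => if d ∣ (i : ℕ) + 1 ∧ d ∣ (j : ℕ) + 1 then g d else 0),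
    ← Finset.sum_filter]
  refine Finset.sum_congr ?_ fun _ _ => rfl
  ext d
  simp only [Finset.mem_filter, Finset.mem_Ioc, Nat.mem_divisors, Nat.dvd_gcd_iff]
  constructor
  · rintro ⟨⟨-, -⟩, hdi, hdj⟩
    exact ⟨⟨hdi, hdj⟩, (Nat.gcd_pos_of_pos_left _ (Nat.succ_pos _)).ne'⟩
  · rintro ⟨⟨hdi, hdj⟩, -⟩
    refine ⟨⟨Nat.pos_of_dvd_of_pos hdi (Nat.succ_pos _), ?_⟩, hdi, hdj⟩
    exact (Nat.le_of_dvd (Nat.succ_pos _) hdi).trans i.2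

/-- `det (f(gcd(i,j)))_{i,j ≤ n} = g(1) g(2) ⋯ g(n)` for `f = ∑_{d ∣ ·} g(d)`.
[cite: BourqueLigh1995, Thm 1 (iii)] -/
theorem det_gcdMatrix (g : ℕ → R) (n : ℕ) :
    (gcdMatrix (fun m => ∑ d ∈ m.divisors, g d) n).det = ∏ k : Fin n, g ((k : ℕ) + 1) := by
  rw [← transpose_mul_diagonal_mul, Matrix.det_mul, Matrix.det_mul, Matrix.det_transpose,
    det_divisibility, Matrix.det_diagonal, one_mul, mul_one]

/-- **Smith's determinant** (1875/76): `det (gcd(i,j))_{1 ≤ i,j ≤ n} = φ(1) φ(2) ⋯ φ(n)`.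
[cite: BeslinLigh1989, Cor 2 (Smith 1875/76, Smith1875)] -/
theorem det_gcd (n : ℕ) :
    (gcdMatrix (fun m => (m : R)) n).det = ∏ k : Fin n, (Nat.totient ((k : ℕ) + 1) : R) := by
  have h : (fun m : ℕ => (m : R)) = fun m => ∑ d ∈ m.divisors, (Nat.totient d : R) := by
    funext m
    rw [← Nat.cast_sum, Nat.sum_totient]
  rw [h, det_gcdMatrix]

/-! ## Positive definiteness -/

/-- **Bourque–Ligh, Thm 1 (i)** on `S = {1, …, n}`: if `g(k) > 0` for `1 ≤ k ≤ n` (i.e. `f ∈ C_S`)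
then `(f(gcd(i,j)))` is positive definite (over `ℝ`). [cite: BourqueLigh1995, Thm 1 (i)] -/
theorem posDef_gcdMatrix {g : ℕ → ℝ} {n : ℕ} (hg : ∀ k, 1 ≤ k → k ≤ n → 0 < g k) :
    (gcdMatrix (fun m => ∑ d ∈ m.divisors, g d) n).PosDef := by
  rw [← transpose_mul_diagonal_mul]
  have hA : (Matrix.diagonal (fun k : Fin n => g ((k : ℕ) + 1))).PosDef :=
    Matrix.PosDef.diagonal fun k => hg _ (Nat.succ_pos _) k.2
  have hB : Function.Injective (divisibility n : Matrix (Fin n) (Fin n) ℝ).mulVec := by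
    refine Matrix.mulVec_injective_iff_isUnit.2 ?_
    rw [Matrix.isUnit_iff_isUnit_det, det_divisibility]
    exact isUnit_one
  have h := hA.conjTranspose_mul_mul_same hB
  rwa [Matrix.conjTranspose_eq_transpose_of_trivial] at h

/-- **Beslin–Ligh, Thm 2** (on `{1, …, n}`): the GCD matrix `(gcd(i,j))` is positive definite.
[cite: BeslinLigh1989, Thm 2] -/
theorem posDef_gcd (n : ℕ) : (gcdMatrix (fun m => (m : ℝ)) n).PosDef := by
  have h : (fun m : ℕ => (m : ℝ)) = fun m => ∑ d ∈ m.divisors, (Nat.totient d : ℝ) := by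
    funext m
    rw [← Nat.cast_sum, Nat.sum_totient]
  rw [h]
  exact posDef_gcdMatrix fun k hk _ => by exact_mod_cast Nat.totient_pos.2 hk

/-! ## Jordan's totient and power GCD matrices -/

/-- Jordan's totient `J_s = μ ∗ N^s` (`∑_{d ∣ m} J_s(d) = m^s`; `J_1 = φ`), as a `ℤ`-valued
arithmetic function. [cite: BourqueLigh1995, p. 268 (`ε_e ∗ μ`)] -/
def jordan (s : ℕ) : ArithmeticFunction ℤ :=
  μ * ((ArithmeticFunction.pow s : ArithmeticFunction ℕ) : ArithmeticFunction ℤ)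

/-- `∑_{d ∣ m} J_s(d) = m^s` (`s ≥ 1`). [cite: BourqueLigh1995, p. 268] -/
theorem sum_divisors_jordan {s : ℕ} (hs : s ≠ 0) (m : ℕ) :
    ∑ d ∈ m.divisors, jordan s d = (m : ℤ) ^ s := by
  have h : ((ArithmeticFunction.zeta : ArithmeticFunction ℕ) : ArithmeticFunction ℤ) * jordan s =
      ((ArithmeticFunction.pow s : ArithmeticFunction ℕ) : ArithmeticFunction ℤ) := by
    rw [jordan, ← mul_assoc, ArithmeticFunction.coe_zeta_mul_moebius, one_mul]
  have h2 := congrArg (fun F : ArithmeticFunction ℤ => F m) h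
  simp only [ArithmeticFunction.coe_zeta_mul_apply, ArithmeticFunction.natCoe_apply,
    ArithmeticFunction.pow_apply, hs, false_and, if_false, Nat.cast_pow] at h2
  exact h2

/-- `J_s` is multiplicative. [cite: BourqueLigh1995, p. 268] -/
theorem isMultiplicative_jordan (s : ℕ) : (jordan s).IsMultiplicative :=
  ArithmeticFunction.isMultiplicative_moebius.mul ArithmeticFunction.isMultiplicative_pow.natCast

/-- `J_s(p^{k+1}) = p^{(k+1)s} - p^{ks}` for a prime `p` (`s ≥ 1`). [cite: BourqueLigh1995, p. 268] -/
theorem jordan_prime_pow_succ {s : ℕ} (hs : s ≠ 0) {p : ℕ} (hp : p.Prime) (k : ℕ) :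
    jordan s (p ^ (k + 1)) = ((p ^ (k + 1) : ℕ) : ℤ) ^ s - ((p ^ k : ℕ) : ℤ) ^ s := by
  have h1 := sum_divisors_jordan hs (p ^ (k + 1))
  have h2 := sum_divisors_jordan hs (p ^ k)
  rw [Nat.divisors_prime_pow hp, Finset.sum_map] at h1 h2
  rw [Finset.sum_range_succ] at h1
  simp only [Function.Embedding.coeFn_mk] at h1 h2
  rw [h2] at h1
  push_cast at h1 ⊢
  linear_combination h1

/-- `J_s(p^{k+1}) > 0` (`s ≥ 1`, `p` prime). [cite: BourqueLigh1995, p. 268] -/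
theorem jordan_prime_pow_succ_pos {s : ℕ} (hs : s ≠ 0) {p : ℕ} (hp : p.Prime) (k : ℕ) :
    0 < jordan s (p ^ (k + 1)) := by
  rw [jordan_prime_pow_succ hs hp k, sub_pos]
  have h : (p ^ k) ^ s < (p ^ (k + 1)) ^ s :=
    Nat.pow_lt_pow_left (Nat.pow_lt_pow_right hp.one_lt (Nat.lt_succ_self k)) hs
  exact_mod_cast h

/-- `J_s(m) > 0` for `m, s ≥ 1` (so `N^s ∈ C_S` for every `S`). [cite: BourqueLigh1995, p. 268] -/
theorem jordan_pos {s : ℕ} (hs : s ≠ 0) {m : ℕ} (hm : m ≠ 0) : 0 < jordan s m := by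
  rw [(isMultiplicative_jordan s).multiplicative_factorization _ hm, Finsupp.prod]
  refine Finset.prod_pos fun p hp => ?_
  have hp' : p.Prime := Nat.prime_of_mem_primeFactors (by rwa [Nat.support_factorization] at hp)
  have hk : m.factorization p ≠ 0 := Finsupp.mem_support_iff.1 hp
  obtain ⟨k, hk'⟩ := Nat.exists_eq_succ_of_ne_zero hk
  rw [hk']
  exact jordan_prime_pow_succ_pos hs hp' k

/-- **Smith's determinant for powers**: `det (gcd(i,j)^s)_{i,j ≤ n} = J_s(1) ⋯ J_s(n)` (`s ≥ 1`).
[cite: BourqueLigh1995, Thm 1 (iii) with `f = ε_s` (Smith1875 for `S = {1,…,n}`)] -/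
theorem det_gcd_pow {s : ℕ} (hs : s ≠ 0) (n : ℕ) :
    (gcdMatrix (fun m => (m : R) ^ s) n).det = ∏ k : Fin n, (jordan s ((k : ℕ) + 1) : R) := by
  have h : (fun m : ℕ => (m : R) ^ s) = fun m => ∑ d ∈ m.divisors, (jordan s d : R) := by
    funext m
    rw [← Int.cast_sum, sum_divisors_jordan hs m]
    push_cast
    rfl
  rw [h, det_gcdMatrix]

/-- **Power GCD matrices are positive definite**: `(gcd(i,j)^s)_{i,j ≤ n}` is positive definite over
`ℝ` for `s ≥ 1` (`ε_s ∈ C_S`). [cite: BourqueLigh1995, Thm 1 (i) and p. 268] -/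
theorem posDef_gcd_pow {s : ℕ} (hs : s ≠ 0) (n : ℕ) :
    (gcdMatrix (fun m => (m : ℝ) ^ s) n).PosDef := by
  have h : (fun m : ℕ => (m : ℝ) ^ s) = fun m => ∑ d ∈ m.divisors, (jordan s d : ℝ) := by
    funext m
    rw [← Int.cast_sum, sum_divisors_jordan hs m]
    push_cast
    rfl
  rw [h]
  exact posDef_gcdMatrix fun k hk _ => by exact_mod_cast jordan_pos hs (by omega : k ≠ 0)

/-! ## Mikolás's Gram matrix of dilated Bernoulli functions -/

/-- **Mikolás's Gram matrix is positive definite at every level.**  For `c > 0` and `t ≥ 1` the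
matrix `(c · gcd(a,b)^{2t} / (a^t b^t))_{1 ≤ a,b ≤ x}` — for `t = 2r+1`, `c = c_r = |B_{4r+2}|/(4r+2)!`
this is the Gram matrix `(∫₀¹ P_{2r+1}(au) P_{2r+1}(bu) du)_{a,b ≤ x}` of Mikolás's Lemma 5
(`r = 0`: Franel's `gcd(a,b)²/(12ab)`) — is positive definite over `ℝ`, being congruent by the
invertible diagonal `diag(a^{-t})` to the GCD matrix of `c·N^{2t} ∈ C_S`.
[cite: Mikolas1949, Lemma 5; BourqueLigh1995, Thm 1 (i)] -/
theorem posDef_mikolasGram {c : ℝ} (hc : 0 < c) {t : ℕ} (ht : t ≠ 0) (x : ℕ) :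
    (Matrix.of fun a b : Fin x =>
      c * (Nat.gcd ((a : ℕ) + 1) ((b : ℕ) + 1) : ℝ) ^ (2 * t) /
        ((((a : ℕ) + 1 : ℕ) : ℝ) ^ t * (((b : ℕ) + 1 : ℕ) : ℝ) ^ t)).PosDef := by
  -- the inner GCD matrix of `c · N^{2t}`
  have hG : (gcdMatrix (fun m => c * (m : ℝ) ^ (2 * t)) x).PosDef := by
    have h : (fun m : ℕ => c * (m : ℝ) ^ (2 * t)) =
        fun m => ∑ d ∈ m.divisors, c * (jordan (2 * t) d : ℝ) := by
      funext m
      rw [← Finset.mul_sum, ← Int.cast_sum, sum_divisors_jordan (by omega) m]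
      push_cast
      rfl
    rw [h]
    exact posDef_gcdMatrix fun k hk _ =>
      mul_pos hc (by exact_mod_cast jordan_pos (by omega) (by omega : k ≠ 0))
  -- congruence by the invertible diagonal `diag((a+1)^{-t})`
  set Δ : Matrix (Fin x) (Fin x) ℝ :=
    Matrix.diagonal fun a : Fin x => ((((a : ℕ) + 1 : ℕ) : ℝ) ^ t)⁻¹ with hΔ
  have hΔ' : Function.Injective Δ.mulVec := by
    refine Matrix.mulVec_injective_iff_isUnit.2 ?_
    rw [Matrix.isUnit_iff_isUnit_det, hΔ, Matrix.det_diagonal]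
    exact isUnit_iff_ne_zero.2
      (Finset.prod_ne_zero_iff.2 fun a _ => inv_ne_zero (pow_ne_zero _ (by positivity)))
  have h := hG.conjTranspose_mul_mul_same hΔ'
  rw [Matrix.conjTranspose_eq_transpose_of_trivial, hΔ, Matrix.diagonal_transpose] at h
  convert h using 1
  ext a b
  rw [Matrix.of_apply, Matrix.mul_diagonal, Matrix.diagonal_mul, gcdMatrix_apply]
  rw [div_eq_mul_inv, mul_inv]
  ring

end Ring

end Smith

end Literature.NumberTheory.Multiplicative
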